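import Summits.HodgeConjecture.HodgeConjecture.Theorems.F0P2aFrameTransport
import Summits.HodgeConjecture.HodgeConjecture.Theorems.H413CohFormsCarriers
import Literature.NumberTheory.Automorphic.UnitaryGroupFrameHermitian
import Literature.AlgebraicGeometry.ShimuraVarieties.UnitaryBallRealPoints
import HarnessLib

/-!
# Crux `H413`, line `F0_P2aCohIsotypicLine` — THE FRAME TRANSPORT TO THE PIN `archFactorOf F V`: every CM engine datum `(L, ι, H, T, hT)`
# is a pin `(F, V)` (B4-archimedean desk, seat F0P2a-p06 (g0); served item `stmt-HodgeConjecture-24833`; shared by S3 / L2b)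

HC_CM is proved only modulo the printed citations until rung 0 closes.

Companion of ★ `Theorems/F0P2aFrameTransport.lean` (generic transport `Φ ↦ Φ(· a)` along an intertwined pair of archimedean sections; frames
`u₀ = T'⁻¹T ∈ U(2,1)`; `exists_frameTransport` between two frames `T, T'` of one CM datum `(L, ι, H)`).  THIS file adds the Summit-side PIN
PACKAGING, THEOREMS ONLY (no `def`, no instance, no named fact, no `sorry`):

* `exists_hermSpace3_Hm_eq` — every CM engine datum IS a pin: for a CM field `L`, `ι`, `H ∈ M₃(L)` with a frame `T` at `ι`
  (`Tᴴ H^ι T = diag(1,1,−1)`) and `H` positive definite at the complex places `≠` that of `ι`, the bundled `⟨L⟩ : HodgeCM.CMField` carries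
  `V : HodgeCM.HermSpace3 ⟨L⟩ ι` with `V.Hm = H` (`H` is hermitian for the CM conjugation by ★ `cmConjRingHom_apply_eq_of_formCongr_eq_J`;
  signature by the frame and ★ `UnitaryBallUniformisationDatum.signatureMatrix_two`).  Consumers `obtain ⟨V, rfl⟩` and read every pin theorem
  (★ `CuspCot.exists_cohClassMap_bijective`, ★ `TowerConj.exists_H10T_add_conjT`, …) at `H = V.Hm`, `L = HodgeCM.CMField.K ⟨L⟩` (by `δ`);
* `archFactorOf_ιinf_eq_cmArchSection`, `archFactorOf_Kc_eq_cmCompactFactor`, `holCotForms_archFactorOf_eq`, `cohForms_archFactorOf_eq` — the factor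
  of record and its carriers ARE the Literature CM objects at HodgeCM's Sylvester frame `V.sylvesterFrame` (`rfl`);
* `exists_frameTransport_pin` / `mem_cohForms_frameTransport_pin` — for ANY frame `T` of `Hm V` at `ι₁`: `∃ a` (in the range of `(archFactorOf F V).ιinf`,
  commuting with `U(V)(𝔸_{F⁺,f})` and with the compact factor, intertwining the sections) with `Φ ∈ hol_T ↔ Φ(· a) ∈ holCotForms (archFactorOf F V)`,
  same for `antihol` and `coh`;
* `exists_linear_frameTransport_pin` — the same packaged as an INJECTIVE `ℂ`-linear map `La` (Mathlib `LinearMap.funLeft`) commuting with `rightRep F V`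
  (so an equivariant `ψ` valued in `coh_T` becomes the equivariant `La ∘ₗ ψ` valued in `cohForms (archFactorOf F V)`, non-zero iff `ψ` is).

## References
* [BorelJacquet1979] A. Borel, H. Jacquet, PSPM 33.1 (1979), §4.1, §4.2.
* [PlatonovRapinchuk1994] V. Platonov, A. Rapinchuk (1994), §2.3.
* [BorelWallach2000] A. Borel, N. Wallach, 2nd ed. (2000), VII 2.10.
* [BergeronMillsonMoeglin2016Balls] N. Bergeron, J. Millson, C. Moeglin, Part 2 §1.1.
-/

-- the mandated namespace repeats `HodgeConjecture.HodgeConjecture`, as in every `Theorems/*.lean` of this sub-problem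
set_option linter.dupNamespace false
set_option autoImplicit false

noncomputable section

open NumberField MulAction
open scoped Matrix ComplexOrder

namespace Summit.HodgeConjecture.HodgeConjecture.Cruxes.H413.F0P2aFrameTransportPin

open Summit.HodgeConjecture.HodgeConjecture.Cruxes.H413.F0P2aFrameTransport
open Literature.NumberTheory.Automorphic Literature.NumberTheory.Automorphic.UnitaryGroup
open Literature.NumberTheory.Automorphic.UnitaryGroup.CotangentForms
open Literature.AlgebraicGeometry.ShimuraVarieties
open Literature.Geometry.ComplexHyperbolic
open Literature.Geometry.ComplexHyperbolic.BallModel (U21 x₀)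

/-! ## §4 Pin packaging: every CM engine datum is a pin `(F, V)`, and the transport to `archFactorOf F V` -/

section Pin

/-- **Every CM engine datum is a pin.**  For a CM field `L`, `ι`, `H ∈ M₃(L)` with a frame `T` at `ι` and `H` positive definite at the complex places
`≠` that of `ι`, the bundled `⟨L⟩ : HodgeCM.CMField` carries a hermitian space `V : HodgeCM.HermSpace3 ⟨L⟩ ι` with Gram matrix `V.Hm = H` (`H` is
hermitian for the CM conjugation by ★ `cmConjRingHom_apply_eq_of_formCongr_eq_J`; signature `(2,1)` at `ι` by the frame, ★ `signatureMatrix_two`).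
Consumers `obtain ⟨V, rfl⟩` and read every pin theorem at `H = V.Hm`, `L = HodgeCM.CMField.K ⟨L⟩` (by `δ`).
[cite: BergeronMillsonMoeglin2016Balls, Part 2 §1.1] [cite: PlatonovRapinchuk1994, §2.3] -/
theorem exists_hermSpace3_Hm_eq (L : Type) [Field L] [NumberField L] [IsCMField L] (ι : L →+* ℂ) (H : Matrix (Fin 3) (Fin 3) L)
    (T : GL (Fin 3) ℂ) (hT : (T : Matrix (Fin 3) (Fin 3) ℂ)ᴴ * H.map ι * (T : Matrix (Fin 3) (Fin 3) ℂ) = BallModel.J)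
    (hdef : ∀ τ' : L →+* ℂ, InfinitePlace.mk τ' ≠ InfinitePlace.mk ι → (H.map τ').PosDef) :
    ∃ V : HodgeCM.HermSpace3 (HodgeCM.CMField.mk L) ι, V.Hm = H :=
  ⟨{ Hm := H
     isHermitian := fun i j => cmConjRingHom_apply_eq_of_formCongr_eq_J L H ι T (formCongr_eq_of_conjTranspose L ι H T hT) i j
     signature_ι₁ := ⟨T, by rw [UnitaryBallUniformisationDatum.signatureMatrix_two]; exact hT⟩
     posDef_of_ne := hdef }, rfl⟩

variable (F : HodgeCM.CMField) {ι₁ : F →+* ℂ} (V : HodgeCM.HermSpace3 F ι₁)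

/-- The section of the factor of record IS the Literature CM section through HodgeCM's Sylvester frame (`rfl`). [cite: BorelJacquet1979, §4.1] -/
theorem archFactorOf_ιinf_eq_cmArchSection : (CohFormsCarriers.archFactorOf F V).ιinf =
    cmArchSection (HodgeCM.CMField.K F) ι₁ (HodgeCM.HermSpace3.Hm V) V.sylvesterFrame (HodgeCM.Model.sylvesterFrame_J V) := rfl

/-- The compact factor of the factor of record IS the Literature CM compact factor through HodgeCM's Sylvester frame (`rfl`).
[cite: BorelJacquet1979, §4.1] -/
theorem archFactorOf_Kc_eq_cmCompactFactor : (CohFormsCarriers.archFactorOf F V).Kc =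
    cmCompactFactor (HodgeCM.CMField.K F) ι₁ (HodgeCM.HermSpace3.Hm V) V.sylvesterFrame (HodgeCM.Model.sylvesterFrame_J V) := rfl

/-- The crux carriers of the factor of record ARE the Literature carriers of the CM datum `(K F, ι₁, Hm V, V.sylvesterFrame)` (`rfl`; cf. ★
`holCotForms_eq_generic`). [cite: BorelWallach2000, VII 2.10] -/
theorem holCotForms_archFactorOf_eq : CohFormsCarriers.holCotForms (CohFormsCarriers.archFactorOf F V) =
    holCotForms (↥(maximalRealSubfield (HodgeCM.CMField.K F))) (HodgeCM.CMField.K F) (IsCMField.complexConj (HodgeCM.CMField.K F)) 3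
      (HodgeCM.HermSpace3.Hm V) (cmArchSection (HodgeCM.CMField.K F) ι₁ (HodgeCM.HermSpace3.Hm V) V.sylvesterFrame
        (HodgeCM.Model.sylvesterFrame_J V))
      (cmCompactFactor (HodgeCM.CMField.K F) ι₁ (HodgeCM.HermSpace3.Hm V) V.sylvesterFrame (HodgeCM.Model.sylvesterFrame_J V)) := rfl

/-- Same for the cohomological cotangent forms (`rfl`). [cite: BorelWallach2000, VII 2.10] -/
theorem cohForms_archFactorOf_eq : CohFormsCarriers.cohForms (CohFormsCarriers.archFactorOf F V) =
    cohForms (↥(maximalRealSubfield (HodgeCM.CMField.K F))) (HodgeCM.CMField.K F) (IsCMField.complexConj (HodgeCM.CMField.K F)) 3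
      (HodgeCM.HermSpace3.Hm V) (cmArchSection (HodgeCM.CMField.K F) ι₁ (HodgeCM.HermSpace3.Hm V) V.sylvesterFrame
        (HodgeCM.Model.sylvesterFrame_J V))
      (cmCompactFactor (HodgeCM.CMField.K F) ι₁ (HodgeCM.HermSpace3.Hm V) V.sylvesterFrame (HodgeCM.Model.sylvesterFrame_J V)) := rfl

variable (T : GL (Fin 3) ℂ)
  (hT : (T : Matrix (Fin 3) (Fin 3) ℂ)ᴴ * (HodgeCM.HermSpace3.Hm V).map ι₁ * (T : Matrix (Fin 3) (Fin 3) ℂ) = BallModel.J)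

/-- **THE TRANSPORT TO THE PIN.**  For any frame `T` of `Hm V` at `ι₁` there is `a ∈ U(V)(𝔸_{F⁺})` in the range of `(archFactorOf F V).ιinf`, commuting
with `U(V)(𝔸_{F⁺,f})` and with the compact factor, intertwining `cmArchSection … T` with `(archFactorOf F V).ιinf`, such that `Φ ↦ Φ(· a)` identifies
the holomorphic / antiholomorphic / cohomological cotangent forms of the frame `T` with the crux carriers of the factor of record.
[cite: BorelJacquet1979, §4.1, §4.2] [cite: BorelWallach2000, VII 2.10] [cite: PlatonovRapinchuk1994, §2.3] -/
theorem exists_frameTransport_pin :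
    ∃ a : (CohFormsCarriers.adelicDatum F V).Adelic,
      a ∈ (CohFormsCarriers.archFactorOf F V).ιinf.range ∧
      (∀ g : ↥(HodgeCM.HermSpace3.adelicFin V), Commute (CohFormsCarriers.finToAdelic F V g) a) ∧
      (∀ k ∈ cmCompactFactor (HodgeCM.CMField.K F) ι₁ (HodgeCM.HermSpace3.Hm V) T hT, Commute k a) ∧
      (∀ u : U21, (CohFormsCarriers.archFactorOf F V).ιinf u * a =
        a * cmArchSection (HodgeCM.CMField.K F) ι₁ (HodgeCM.HermSpace3.Hm V) T hT u) ∧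
      (∀ Φ : (CohFormsCarriers.adelicDatum F V).Adelic → (Fin 2 → ℂ),
        Φ ∈ holCotForms (↥(maximalRealSubfield (HodgeCM.CMField.K F))) (HodgeCM.CMField.K F) (IsCMField.complexConj (HodgeCM.CMField.K F)) 3
          (HodgeCM.HermSpace3.Hm V) (cmArchSection (HodgeCM.CMField.K F) ι₁ (HodgeCM.HermSpace3.Hm V) T hT)
          (cmCompactFactor (HodgeCM.CMField.K F) ι₁ (HodgeCM.HermSpace3.Hm V) T hT) ↔
        (fun y => Φ (y * a)) ∈ CohFormsCarriers.holCotForms (CohFormsCarriers.archFactorOf F V)) ∧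
      (∀ Φ : (CohFormsCarriers.adelicDatum F V).Adelic → (Fin 2 → ℂ),
        Φ ∈ (holCotForms (↥(maximalRealSubfield (HodgeCM.CMField.K F))) (HodgeCM.CMField.K F) (IsCMField.complexConj (HodgeCM.CMField.K F)) 3
          (HodgeCM.HermSpace3.Hm V) (cmArchSection (HodgeCM.CMField.K F) ι₁ (HodgeCM.HermSpace3.Hm V) T hT)
          (cmCompactFactor (HodgeCM.CMField.K F) ι₁ (HodgeCM.HermSpace3.Hm V) T hT)).map
          (conjFun (↥(maximalRealSubfield (HodgeCM.CMField.K F))) (HodgeCM.CMField.K F) (IsCMField.complexConj (HodgeCM.CMField.K F)) 3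
            (HodgeCM.HermSpace3.Hm V)) ↔
        (fun y => Φ (y * a)) ∈ (CohFormsCarriers.holCotForms (CohFormsCarriers.archFactorOf F V)).map (CohFormsCarriers.conjFun F V)) ∧
      (∀ Φ : (CohFormsCarriers.adelicDatum F V).Adelic → (Fin 2 → ℂ),
        Φ ∈ cohForms (↥(maximalRealSubfield (HodgeCM.CMField.K F))) (HodgeCM.CMField.K F) (IsCMField.complexConj (HodgeCM.CMField.K F)) 3
          (HodgeCM.HermSpace3.Hm V) (cmArchSection (HodgeCM.CMField.K F) ι₁ (HodgeCM.HermSpace3.Hm V) T hT)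
          (cmCompactFactor (HodgeCM.CMField.K F) ι₁ (HodgeCM.HermSpace3.Hm V) T hT) ↔
        (fun y => Φ (y * a)) ∈ CohFormsCarriers.cohForms (CohFormsCarriers.archFactorOf F V)) :=
  exists_frameTransport (HodgeCM.CMField.K F) ι₁ (HodgeCM.HermSpace3.Hm V) T V.sylvesterFrame hT (HodgeCM.Model.sylvesterFrame_J V)

/-- **The transport to the pin, one-way consumer spelling**: `∃ a` commuting with `U(V)(𝔸_{F⁺,f})` with `Φ ∈ coh_T ⇒ Φ(· a) ∈ cohForms (archFactorOf F V)`.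
[cite: BorelJacquet1979, §4.1, §4.2] [cite: BorelWallach2000, VII 2.10] -/
theorem mem_cohForms_frameTransport_pin :
    ∃ a : (CohFormsCarriers.adelicDatum F V).Adelic,
      (∀ g : ↥(HodgeCM.HermSpace3.adelicFin V), Commute (CohFormsCarriers.finToAdelic F V g) a) ∧
      ∀ f ∈ cohForms (↥(maximalRealSubfield (HodgeCM.CMField.K F))) (HodgeCM.CMField.K F) (IsCMField.complexConj (HodgeCM.CMField.K F)) 3
          (HodgeCM.HermSpace3.Hm V) (cmArchSection (HodgeCM.CMField.K F) ι₁ (HodgeCM.HermSpace3.Hm V) T hT)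
          (cmCompactFactor (HodgeCM.CMField.K F) ι₁ (HodgeCM.HermSpace3.Hm V) T hT),
        (fun y => f (y * a)) ∈ CohFormsCarriers.cohForms (CohFormsCarriers.archFactorOf F V) := by
  obtain ⟨a, -, haf, -, -, -, -, hcoh⟩ := exists_frameTransport_pin F V T hT
  exact ⟨a, haf, fun f hf => (hcoh f).mp hf⟩

/-- **The transport to the pin as an INJECTIVE EQUIVARIANT LINEAR MAP** (the shape an admissibility / multiplicity argument consumes): for any frame
`T` of `Hm V` at `ι₁` there is a `ℂ`-linear injective `La` on `ℂ²`-valued functions (right translation by the `a` of `exists_frameTransport_pin`,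
Mathlib `LinearMap.funLeft`) commuting with the finite-adelic right translation `rightRep F V` and carrying `hol_T`, `antihol_T`, `coh_T` onto the
crux carriers of `archFactorOf F V` (membership both ways).  So a `rightRep`-equivariant `ψ : W →ₗ (U(V)(𝔸) → ℂ²)` valued in `coh_T` gives
`La ∘ₗ ψ`, equivariant, valued in `cohForms (archFactorOf F V)`, and non-zero iff `ψ` is. [cite: BorelJacquet1979, §4.1, §4.2] [cite: BorelWallach2000, VII 2.10] -/
theorem exists_linear_frameTransport_pin :
    ∃ La : ((CohFormsCarriers.adelicDatum F V).Adelic → (Fin 2 → ℂ)) →ₗ[ℂ] ((CohFormsCarriers.adelicDatum F V).Adelic → (Fin 2 → ℂ)),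
      Function.Injective La ∧
      (∀ (g : ↥(HodgeCM.HermSpace3.adelicFin V)) (Φ : (CohFormsCarriers.adelicDatum F V).Adelic → (Fin 2 → ℂ)),
        CohFormsCarriers.rightRep F V g (La Φ) = La (CohFormsCarriers.rightRep F V g Φ)) ∧
      (∀ Φ : (CohFormsCarriers.adelicDatum F V).Adelic → (Fin 2 → ℂ),
        Φ ∈ holCotForms (↥(maximalRealSubfield (HodgeCM.CMField.K F))) (HodgeCM.CMField.K F) (IsCMField.complexConj (HodgeCM.CMField.K F)) 3
          (HodgeCM.HermSpace3.Hm V) (cmArchSection (HodgeCM.CMField.K F) ι₁ (HodgeCM.HermSpace3.Hm V) T hT)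
          (cmCompactFactor (HodgeCM.CMField.K F) ι₁ (HodgeCM.HermSpace3.Hm V) T hT) ↔
        La Φ ∈ CohFormsCarriers.holCotForms (CohFormsCarriers.archFactorOf F V)) ∧
      (∀ Φ : (CohFormsCarriers.adelicDatum F V).Adelic → (Fin 2 → ℂ),
        Φ ∈ (holCotForms (↥(maximalRealSubfield (HodgeCM.CMField.K F))) (HodgeCM.CMField.K F) (IsCMField.complexConj (HodgeCM.CMField.K F)) 3
          (HodgeCM.HermSpace3.Hm V) (cmArchSection (HodgeCM.CMField.K F) ι₁ (HodgeCM.HermSpace3.Hm V) T hT)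
          (cmCompactFactor (HodgeCM.CMField.K F) ι₁ (HodgeCM.HermSpace3.Hm V) T hT)).map
          (conjFun (↥(maximalRealSubfield (HodgeCM.CMField.K F))) (HodgeCM.CMField.K F) (IsCMField.complexConj (HodgeCM.CMField.K F)) 3
            (HodgeCM.HermSpace3.Hm V)) ↔
        La Φ ∈ (CohFormsCarriers.holCotForms (CohFormsCarriers.archFactorOf F V)).map (CohFormsCarriers.conjFun F V)) ∧
      (∀ Φ : (CohFormsCarriers.adelicDatum F V).Adelic → (Fin 2 → ℂ),
        Φ ∈ cohForms (↥(maximalRealSubfield (HodgeCM.CMField.K F))) (HodgeCM.CMField.K F) (IsCMField.complexConj (HodgeCM.CMField.K F)) 3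
          (HodgeCM.HermSpace3.Hm V) (cmArchSection (HodgeCM.CMField.K F) ι₁ (HodgeCM.HermSpace3.Hm V) T hT)
          (cmCompactFactor (HodgeCM.CMField.K F) ι₁ (HodgeCM.HermSpace3.Hm V) T hT) ↔
        La Φ ∈ CohFormsCarriers.cohForms (CohFormsCarriers.archFactorOf F V)) := by
  obtain ⟨a, -, haf, -, -, hhol, hanti, hcoh⟩ := exists_frameTransport_pin F V T hT
  refine ⟨LinearMap.funLeft ℂ (Fin 2 → ℂ) fun y => y * a, LinearMap.funLeft_injective_of_surjective ℂ (Fin 2 → ℂ) _ (mul_right_surjective a),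
    fun g Φ => ?_, hhol, hanti, hcoh⟩
  exact rightRep_comp_mul_right haf g Φ

end Pin

end Summit.HodgeConjecture.HodgeConjecture.Cruxes.H413.F0P2aFrameTransportPin

end
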